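import Summits.Ventures.CertifiedQuantumChemistry.Hamiltonians.Tables
import Summits.Ventures.CertifiedQuantumChemistry.Rows.ModelPinFourfold
import HarnessLib

/-!
# Ventures/CertifiedQuantumChemistry — Hamiltonians/Tables4.lean: literal models from 4-FOLD canonical integral tables (DRESSED files)
# (sibling of `Hamiltonians/Tables.lean`; nothing there is edited)

HONEST FRAMING (verbatim): certified bounds for a stated model Hamiltonian in a stated basis; not a
claim about the real molecule or material beyond that model.

A DRESSED (similarity-transformed / folded) integral file — wave-4 W4-6 tranche (c), chem-model-3 DESIGN-D7 ADDENDUM 14 (R1-3);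
the G₄ file of record `…_s0.25_Hbar_g4.fcidump` cf58eafa… is written **4-FOLD-UNIQUE** (chem-ref-2 g21 RC.1122 / INBOX l.6681: 9 751 two-electron
literal lines = N₄(14) = (14⁴ + 3·14²)/4 G₄ orbits, one literal per orbit) — carries a two-electron table with only the 4-fold symmetry
group G₄ = {(pq|rs), (qp|sr), (rs|pq), (sr|qp)} (`Model.IsFourfold`, Rows/ModelPinFourfold.lean), NOT the real 8-fold group of
`Hamiltonians/Tables.lean`'s `quadKey` (which also sorts each pair separately and would MERGE distinct dressed integrals). This file is the
4-fold twin of `Model.ofTables`: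

* `code4 k p q r s = ((p·k + q)·k + r)·k + s` — the base-`k` code of an ordered quadruple of 0-based indices (injective for indices `< k`;
  decode: `s = c % k`, `r = (c / k) % k`, `q = (c / k²) % k`, `p = c / k³`);
* `quadKey4 k p q r s` — the CANONICAL G₄ KEY := the least code over the four images (a natural number);
  `quadKey4_swap` (`(pq|rs) ↔ (qp|sr)`) and `quadKey4_exch` (`(pq|rs) ↔ (rs|pq)`) fix it (`Nat.min_comm` only — no order theory on tuples);
* `Model.ofTables4 k hT eT ecore` — `hT` keyed by `pairKey` as before, `eT : List (ℕ × (ℤ × ℕ))` keyed by `quadKey4 k` (absent key = 0);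
  `Model.ofTables4_isFourfold`, `Model.ofTables4_isSymmetric`, `Model.ofTables4_hamiltonian_isHermitian`.

The typer's generator for a G₄ file emits `eT` with the key `quadKey4 k` computed from each printed line's indices (0-based) and ASSERTS that
no two printed lines share a key (4-fold-unique file) — or, for a file printing several images, that all images of one orbit agree.
Nothing is asserted about any file here. Typed by chem-type-07 (B8-1 slot 07, gen 13) ahead of the first W4-6 (c) row.
-/

namespace Summit.Ventures.CertifiedQuantumChemistry

/-- Base-`k` code of an ordered index quadruple: `((p·k + q)·k + r)·k + s` (injective on 0-based indices `< k`). -/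
def code4 (k p q r s : ℕ) : ℕ := ((p * k + q) * k + r) * k + s

/-- **Canonical G₄ key** of `(pq|rs)` for a DRESSED table: the least base-`k` code over the 4-fold orbit
`{(p,q,r,s), (q,p,s,r), (r,s,p,q), (s,r,q,p)}`. [cite: KnowlesHandy1989, §2 (FCIDUMP format)] -/
def quadKey4 (k p q r s : ℕ) : ℕ :=
  min (min (code4 k p q r s) (code4 k q p s r)) (min (code4 k r s p q) (code4 k s r q p))

/-- The joint transpose `(pq|rs) ↔ (qp|sr)` fixes the G₄ key. -/
theorem quadKey4_swap (k p q r s : ℕ) : quadKey4 k p q r s = quadKey4 k q p s r := by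
  unfold quadKey4
  rw [Nat.min_comm (code4 k q p s r) (code4 k p q r s), Nat.min_comm (code4 k s r q p) (code4 k r s p q)]

/-- The pair exchange `(pq|rs) ↔ (rs|pq)` fixes the G₄ key. -/
theorem quadKey4_exch (k p q r s : ℕ) : quadKey4 k p q r s = quadKey4 k r s p q := by
  unfold quadKey4
  rw [Nat.min_comm (min (code4 k r s p q) (code4 k s r q p)) (min (code4 k p q r s) (code4 k q p s r))]

namespace Model

/-- A literal DRESSED model from 4-fold canonical tables: `hT` keyed by `pairKey` (h is symmetric on a dressed file of record), `eT` keyed by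
`quadKey4 k` (0-based indices; values as (numerator, denominator) pairs; absent key = 0), plus the scalar `ecore`. -/
def ofTables4 (k : ℕ) (hT : List ((ℕ × ℕ) × (ℤ × ℕ))) (eT : List (ℕ × (ℤ × ℕ))) (ecore : ℚ) : Model k where
  h p q := ((hT.lookup (pairKey p.val q.val)).map entryVal).getD 0
  eri p q r s := ((eT.lookup (quadKey4 k p.val q.val r.val s.val)).map entryVal).getD 0
  ecore := ecore

/-- A model given by 4-fold canonical tables has the 4-FOLD symmetry (`Model.IsFourfold`) by construction. -/
theorem ofTables4_isFourfold (k : ℕ) (hT : List ((ℕ × ℕ) × (ℤ × ℕ))) (eT : List (ℕ × (ℤ × ℕ))) (ecore : ℚ) :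
    (ofTables4 k hT eT ecore).IsFourfold := by
  refine ⟨fun p q => ?_, fun p q r s => ?_, fun p q r s => ?_⟩
  · simp only [ofTables4, pairKey_comm p.val q.val]
  · simp only [ofTables4, quadKey4_swap k p.val q.val r.val s.val]
  · simp only [ofTables4, quadKey4_exch k p.val q.val r.val s.val]

/-- Hence it is symmetric in the minimal sense (`Model.IsSymmetric`): its Hamiltonian is Hermitian and every (L)/(U) soundness theorem applies. -/
theorem ofTables4_isSymmetric (k : ℕ) (hT : List ((ℕ × ℕ) × (ℤ × ℕ))) (eT : List (ℕ × (ℤ × ℕ))) (ecore : ℚ) :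
    (ofTables4 k hT eT ecore).IsSymmetric :=
  (ofTables4_isFourfold k hT eT ecore).isSymmetric

/-- Hermiticity of the Hamiltonian of a 4-fold table model. -/
theorem ofTables4_hamiltonian_isHermitian (k : ℕ) (hT : List ((ℕ × ℕ) × (ℤ × ℕ))) (eT : List (ℕ × (ℤ × ℕ))) (ecore : ℚ) :
    (ofTables4 k hT eT ecore).hamiltonian.IsHermitian :=
  hamiltonian_isHermitian (ofTables4_isSymmetric k hT eT ecore)

end Model

/-- Sanity probe of the key on a small example: the four images of `(0 1|2 3)` at `k = 4` share the key `27 = code4 4 0 1 2 3`, while the 8-fold image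
`(1 0|2 3)` — NOT a G₄ image — has a DIFFERENT key (`30`): the 4-fold table keeps dressed integrals that the 8-fold key would merge. -/
theorem quadKey4_probe :
    quadKey4 4 0 1 2 3 = 27 ∧ quadKey4 4 1 0 3 2 = 27 ∧ quadKey4 4 2 3 0 1 = 27 ∧ quadKey4 4 3 2 1 0 = 27 ∧ quadKey4 4 1 0 2 3 = 30 := by
  decide

end Summit.Ventures.CertifiedQuantumChemistry
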